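import Mathlib

/-!
# Uniform convexity of the hard-sphere mathematical entropy — tools

Helper file for the route support item `CollisionIsometryCLT.HsEntropyUniformlyConvex`
(stmt-AtomisticToContinuum-9525): the mathematical entropy of the hard-sphere Euler system
`-η_σ(ρ, m, E) = -ρ (3/2 log(2/3 ε) - log ρ - f_ex(ρσ³))`, `ε = E/ρ - ‖m‖²/(2ρ²)`, is uniformly
convex on every typed chamber `{c₁/2 < ρ, ρσ³ < η₀, ‖m‖² < 2ρE, E < E₁}`.

This file collects the tools of the proof that do not involve the Hessian budget:
* `convexOn_of_convexOn_segments` — a function is convex on `s` as soon as all its restrictions to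
  the parameter sets `{t | x + t • (y - x) ∈ s}` of segments with endpoints in `s` are convex;
* `convex_kineticChamber`, `convex_typedChamber` — convexity of `{c < ρ, ‖m‖² < 2ρE, E < E₁}`
  (`0 ≤ c`), by the exact identity
  `(aρ₁ + bρ₂)(aρ₂‖m₁‖² + bρ₁‖m₂‖²) - ρ₁ρ₂‖am₁ + bm₂‖² = ab‖ρ₂m₁ - ρ₁m₂‖²`, and of the typed chamber;
* first and second derivatives along a straight line `t ↦ (ρ₀ + ta, m₀ + t•b, E₀ + tc)` of the
  internal energy density `w = E - ‖m‖²/(2ρ)` and of the ideal-gas part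
  `(3/2)(ρ log ρ - ρ log w) + μρ² - m(ρ² + ‖m‖² + E²)`; the key formula is
  `(ρ log ρ - ρ log w)'' = ρ (a/ρ - w'/w)² - ρ w''/w` for `ρ` affine;
* `eosEntropy_convexOn` — the one-variable convexity of the equation-of-state part
  `ρ ↦ ρ log ρ + ρF(ρσ³) - κρ - μρ²` on `(0, η₀/σ³)` when `2ηF′ + η²F″ ≥ -1/2` on `(0, η₀)` and
  `4μη₀ ≤ σ³`.

Everything here is elementary calculus (A. Harten, J. Comput. Phys. 49 (1983) 151, for the
convexity criterion of `-ρs` in conserved variables). [folklore]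
-/

noncomputable section

namespace Summit.AtomisticToContinuum.HydrodynamicLimit.Theorems

open Set

open scoped RealInnerProductSpace

/-- **Segment criterion for convexity.** If for all `x, y ∈ s` the restriction
`t ↦ f (x + t • (y - x))` is convex on the (automatically convex) parameter set
`{t | x + t • (y - x) ∈ s}`, then `f` is convex on `s` (and `s` is convex). [folklore] -/
theorem convexOn_of_convexOn_segments {E : Type*} [AddCommGroup E] [Module ℝ E] {s : Set E}
    {f : E → ℝ}
    (h : ∀ x ∈ s, ∀ y ∈ s,
      ConvexOn ℝ {t : ℝ | x + t • (y - x) ∈ s} (fun t => f (x + t • (y - x)))) :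
    ConvexOn ℝ s f := by
  have key : ∀ x y : E, ∀ a b : ℝ, a + b = 1 → a • x + b • y = x + b • (y - x) := by
    intro x y a b hab
    have ha : a = 1 - b := by linarith
    rw [ha, sub_smul, one_smul, smul_sub]
    abel
  refine ⟨?_, ?_⟩
  · intro x hx y hy a b ha hb hab
    have hD := (h x hx y hy).1
    have h0 : (0 : ℝ) ∈ {t : ℝ | x + t • (y - x) ∈ s} := by simpa using hx
    have h1 : (1 : ℝ) ∈ {t : ℝ | x + t • (y - x) ∈ s} := by simpa using hy
    have hb' := hD h0 h1 ha hb hab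
    simp only [smul_eq_mul, mul_zero, mul_one, zero_add, mem_setOf_eq] at hb'
    rw [key x y a b hab]
    exact hb'
  · intro x hx y hy a b ha hb hab
    have hD := h x hx y hy
    have h0 : (0 : ℝ) ∈ {t : ℝ | x + t • (y - x) ∈ s} := by simpa using hx
    have h1 : (1 : ℝ) ∈ {t : ℝ | x + t • (y - x) ∈ s} := by simpa using hy
    have := hD.2 h0 h1 ha hb hab
    simp only [smul_eq_mul, mul_zero, mul_one, zero_add, zero_smul, add_zero, one_smul,
      add_sub_cancel] at this
    rw [key x y a b hab]
    exact this

variable {V : Type*} [NormedAddCommGroup V] [InnerProductSpace ℝ V]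

/-- The exact defect identity behind the convexity of the kinetic chamber:
`(aρ₁ + bρ₂)(aρ₂‖m₁‖² + bρ₁‖m₂‖²) - ρ₁ρ₂‖a m₁ + b m₂‖² = ab ‖ρ₂ m₁ - ρ₁ m₂‖²`. [folklore] -/
theorem kineticChamber_defect_identity (ρ₁ ρ₂ a b : ℝ) (m₁ m₂ : V) :
    (a * ρ₁ + b * ρ₂) * (a * ρ₂ * ‖m₁‖ ^ 2 + b * ρ₁ * ‖m₂‖ ^ 2)
      - ρ₁ * ρ₂ * ‖a • m₁ + b • m₂‖ ^ 2 = a * b * ‖ρ₂ • m₁ - ρ₁ • m₂‖ ^ 2 := by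
  rw [norm_add_sq_real, norm_sub_sq_real, norm_smul, norm_smul, norm_smul, norm_smul,
    real_inner_smul_left, real_inner_smul_right, real_inner_smul_left, real_inner_smul_right]
  simp only [Real.norm_eq_abs, mul_pow, sq_abs]
  ring

/-- Convex combinations with `a + b = 1` of a constant. [folklore] -/
theorem convexComb_const (a b r : ℝ) (hab : a + b = 1) : a * r + b * r = r := by
  rw [← add_mul, hab, one_mul]

/-- **Convexity of the kinetic chamber** `{c < ρ, ‖m‖² < 2ρE, E < E₁}` for `0 ≤ c`: the middle
condition is `E > ‖m‖²/(2ρ)`, the strict epigraph of the (jointly convex) kinetic energy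
`‖m‖²/(2ρ)` on `ρ > 0`. [folklore] -/
theorem convex_kineticChamber (c E₁ : ℝ) (hc : 0 ≤ c) :
    Convex ℝ {U : ℝ × V × ℝ | c < U.1 ∧ ‖U.2.1‖ ^ 2 < 2 * U.1 * U.2.2 ∧ U.2.2 < E₁} := by
  intro x hx y hy a b ha hb hab
  obtain ⟨hx1, hx2, hx3⟩ := hx
  obtain ⟨hy1, hy2, hy3⟩ := hy
  simp only [mem_setOf_eq, Prod.fst_add, Prod.smul_fst, Prod.snd_add, Prod.smul_snd, smul_eq_mul]
  have hρx : 0 < x.1 := hc.trans_lt hx1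
  have hρy : 0 < y.1 := hc.trans_lt hy1
  have hcc := convexComb_const a b c hab
  have hEE := convexComb_const a b E₁ hab
  -- `a (x - r) + b (y - r) > 0` for `x, y > r`
  have hpos : ∀ p q : ℝ, 0 < p → 0 < q → 0 < a * p + b * q := by
    intro p q hp hq
    rcases ha.lt_or_eq with ha' | ha'
    · have := mul_pos ha' hp
      have := mul_nonneg hb hq.le
      linarith
    · have hb1 : b = 1 := by linarith
      rw [← ha', hb1]; linarith
  refine ⟨?_, ?_, ?_⟩
  · have := hpos (x.1 - c) (y.1 - c) (by linarith) (by linarith)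
    nlinarith
  · -- the strict epigraph of the kinetic energy is convex
    have hid := kineticChamber_defect_identity x.1 y.1 a b x.2.1 y.2.1
    have hP : 0 < a * x.1 + b * y.1 := hpos x.1 y.1 hρx hρy
    have hdef : 0 ≤ a * b * ‖y.1 • x.2.1 - x.1 • y.2.1‖ ^ 2 := by positivity
    -- `a ρ₂ ‖m₁‖² + b ρ₁ ‖m₂‖² < 2 ρ₁ ρ₂ (a E₁ + b E₂)`
    have h1 : 0 < y.1 * (2 * x.1 * x.2.2 - ‖x.2.1‖ ^ 2) := mul_pos hρy (by linarith)
    have h2 : 0 < x.1 * (2 * y.1 * y.2.2 - ‖y.2.1‖ ^ 2) := mul_pos hρx (by linarith)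
    have hstrict := hpos _ _ h1 h2
    have hle : x.1 * y.1 * ‖a • x.2.1 + b • y.2.1‖ ^ 2
        ≤ (a * x.1 + b * y.1) * (a * y.1 * ‖x.2.1‖ ^ 2 + b * x.1 * ‖y.2.1‖ ^ 2) := by linarith
    have hlt : (a * x.1 + b * y.1) * (a * y.1 * ‖x.2.1‖ ^ 2 + b * x.1 * ‖y.2.1‖ ^ 2)
        < (a * x.1 + b * y.1) * (2 * x.1 * y.1 * (a * x.2.2 + b * y.2.2)) := by
      refine mul_lt_mul_of_pos_left ?_ hP
      linarith
    have hxy : 0 < x.1 * y.1 := mul_pos hρx hρy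
    have key : x.1 * y.1 * ‖a • x.2.1 + b • y.2.1‖ ^ 2
        < x.1 * y.1 * (2 * (a * x.1 + b * y.1) * (a * x.2.2 + b * y.2.2)) := by linarith
    exact lt_of_mul_lt_mul_left key hxy.le
  · have := hpos (E₁ - x.2.2) (E₁ - y.2.2) (by linarith) (by linarith)
    nlinarith

/-! ### Derivatives along a straight line -/

/-- First derivative of `t ↦ ρ log ρ - ρ log w` along a path: with `ρ' = a`, `w' = w₁`,
`(ρ log ρ - ρ log w)' = a log ρ + a - a log w - ρ w₁ / w`. [folklore] -/
theorem hasDerivAt_mul_log_sub_mul_log {ρ w : ℝ → ℝ} {a w₁ t : ℝ} (hρ : HasDerivAt ρ a t)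
    (hw : HasDerivAt w w₁ t) (hρ0 : ρ t ≠ 0) (hw0 : w t ≠ 0) :
    HasDerivAt (fun s => ρ s * Real.log (ρ s) - ρ s * Real.log (w s))
      (a * Real.log (ρ t) + a - a * Real.log (w t) - ρ t * w₁ / w t) t := by
  have h := (hρ.mul (hρ.log hρ0)).sub (hρ.mul (hw.log hw0))
  refine h.congr_deriv ?_
  field_simp
  ring

/-- Second derivative of `t ↦ ρ log ρ - ρ log w` along a path with `ρ` affine (`ρ' = a`
constant), `w' = w₁`, `w₁' = w₂`:
`(a log ρ + a - a log w - ρ w₁ / w)' = ρ (a/ρ - w₁/w)² - ρ w₂ / w`. [folklore] -/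
theorem hasDerivAt_mul_log_sub_mul_log_deriv {ρ w w₁ : ℝ → ℝ} {a w₂ t : ℝ}
    (hρ : HasDerivAt ρ a t) (hw : HasDerivAt w (w₁ t) t) (hw₁ : HasDerivAt w₁ w₂ t)
    (hρ0 : ρ t ≠ 0) (hw0 : w t ≠ 0) :
    HasDerivAt (fun s => a * Real.log (ρ s) + a - a * Real.log (w s) - ρ s * w₁ s / w s)
      (ρ t * (a / ρ t - w₁ t / w t) ^ 2 - ρ t * w₂ / w t) t := by
  have h1 := ((hρ.log hρ0).const_mul a).add_const a
  have h2 := (hw.log hw0).const_mul a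
  have h3 := (hρ.mul hw₁).div hw hw0
  refine ((h1.sub h2).sub h3).congr_deriv ?_
  simp only [Pi.mul_apply]
  field_simp
  ring

/-- First derivative of the internal energy density `w = E - q/(2ρ)` along a path with
`ρ' = a`, `E' = c`, `q' = q₁`: `w' = c - q₁/(2ρ) + a q/(2ρ²)`. [folklore] -/
theorem hasDerivAt_internalEnergy {ρ E q : ℝ → ℝ} {a c q₁ t : ℝ} (hρ : HasDerivAt ρ a t)
    (hE : HasDerivAt E c t) (hq : HasDerivAt q q₁ t) (hρ0 : ρ t ≠ 0) :
    HasDerivAt (fun s => E s - q s / (2 * ρ s))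
      (c - q₁ / (2 * ρ t) + a * q t / (2 * ρ t ^ 2)) t := by
  have h := hE.sub (hq.div (hρ.const_mul 2) (mul_ne_zero two_ne_zero hρ0))
  refine h.congr_deriv ?_
  field_simp
  ring

/-- Second derivative of the internal energy density along a straight line: with `ρ' = a`,
`q' = q₁`, `q₁' = q₂`, `(c - q₁/(2ρ) + a q/(2ρ²))' = -q₂/(2ρ) + a q₁/ρ² - a² q/ρ³`. [folklore] -/
theorem hasDerivAt_internalEnergy_deriv {ρ q q₁ : ℝ → ℝ} {a c q₂ t : ℝ} (hρ : HasDerivAt ρ a t)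
    (hq : HasDerivAt q (q₁ t) t) (hq₁ : HasDerivAt q₁ q₂ t) (hρ0 : ρ t ≠ 0) :
    HasDerivAt (fun s => c - q₁ s / (2 * ρ s) + a * q s / (2 * ρ s ^ 2))
      (-q₂ / (2 * ρ t) + a * q₁ t / ρ t ^ 2 - a ^ 2 * q t / ρ t ^ 3) t := by
  have h1 := hq₁.div (hρ.const_mul 2) (mul_ne_zero two_ne_zero hρ0)
  have h2 := (hq.const_mul a).div ((hρ.pow 2).const_mul 2)
    (mul_ne_zero two_ne_zero (pow_ne_zero 2 hρ0))
  refine ((h1.const_sub c).add h2).congr_deriv ?_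
  simp only [Pi.pow_apply, Nat.cast_ofNat, Nat.add_one_sub_one, pow_one]
  field_simp
  ring

/-- First derivative of the ideal-gas part
`(3/2)(ρ log ρ - ρ log w) + μρ² - m(ρ² + q + E²)` along a path with `ρ' = a`, `E' = c`,
`q' = q₁`, `w' = w₁`. [folklore] -/
theorem hasDerivAt_idealLine {ρ E q w : ℝ → ℝ} {a c q₁ w₁ μ m t : ℝ} (hρ : HasDerivAt ρ a t)
    (hE : HasDerivAt E c t) (hq : HasDerivAt q q₁ t) (hw : HasDerivAt w w₁ t) (hρ0 : ρ t ≠ 0)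
    (hw0 : w t ≠ 0) :
    HasDerivAt (fun s => 3 / 2 * (ρ s * Real.log (ρ s) - ρ s * Real.log (w s)) + μ * ρ s ^ 2
        - m * (ρ s ^ 2 + q s + E s ^ 2))
      (3 / 2 * (a * Real.log (ρ t) + a - a * Real.log (w t) - ρ t * w₁ / w t)
        + 2 * μ * ρ t * a - m * (2 * ρ t * a + q₁ + 2 * E t * c)) t := by
  have h1 := (hasDerivAt_mul_log_sub_mul_log hρ hw hρ0 hw0).const_mul (3 / 2)
  have h2 := (hρ.pow 2).const_mul μ
  have h3 := (((hρ.pow 2).add hq).add (hE.pow 2)).const_mul m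
  refine ((h1.add h2).sub h3).congr_deriv ?_
  simp only [Nat.cast_ofNat, Nat.add_one_sub_one, pow_one]
  ring

/-- Second derivative of the ideal-gas part along a straight line (`ρ'' = E'' = 0`,
`q₁' = q₂`, `w₁' = w₂`):
`(3/2)(ρ (a/ρ - w₁/w)² - ρ w₂/w) + 2μa² - m(2a² + q₂ + 2c²)`. [folklore] -/
theorem hasDerivAt_idealLine_deriv {ρ E w w₁ q₁ : ℝ → ℝ} {a c q₂ w₂ μ m t : ℝ}
    (hρ : HasDerivAt ρ a t) (hE : HasDerivAt E c t) (hq₁ : HasDerivAt q₁ q₂ t)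
    (hw : HasDerivAt w (w₁ t) t) (hw₁ : HasDerivAt w₁ w₂ t) (hρ0 : ρ t ≠ 0) (hw0 : w t ≠ 0) :
    HasDerivAt (fun s => 3 / 2 * (a * Real.log (ρ s) + a - a * Real.log (w s) - ρ s * w₁ s / w s)
        + 2 * μ * ρ s * a - m * (2 * ρ s * a + q₁ s + 2 * E s * c))
      (3 / 2 * (ρ t * (a / ρ t - w₁ t / w t) ^ 2 - ρ t * w₂ / w t)
        + 2 * μ * a ^ 2 - m * (2 * a ^ 2 + q₂ + 2 * c ^ 2)) t := by
  have h1 := (hasDerivAt_mul_log_sub_mul_log_deriv hρ hw hw₁ hρ0 hw0).const_mul (3 / 2)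
  have h2 := (hρ.const_mul (2 * μ)).mul_const a
  have h3 := ((((hρ.const_mul 2).mul_const a).add hq₁).add ((hE.const_mul 2).mul_const c)).const_mul m
  refine ((h1.add h2).sub h3).congr_deriv ?_
  ring

/-- The squared norm along a straight line and its derivative:
`‖m₀ + t • b‖²' = 2 ⟪m₀ + t • b, b⟫`. [folklore] -/
theorem hasDerivAt_norm_sq_line (m₀ b : V) (t : ℝ) :
    HasDerivAt (fun s : ℝ => ‖m₀ + s • b‖ ^ 2) (2 * ⟪m₀ + t • b, b⟫) t := by
  have h : HasDerivAt (fun s : ℝ => m₀ + s • b) b t := by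
    simpa using ((hasDerivAt_id t).smul_const b).const_add m₀
  exact h.norm_sq

/-- `⟪m₀ + t • b, b⟫ = ⟪m₀, b⟫ + t ‖b‖²`. [folklore] -/
theorem inner_line (m₀ b : V) (t : ℝ) : ⟪m₀ + t • b, b⟫ = ⟪m₀, b⟫ + t * ‖b‖ ^ 2 := by
  rw [inner_add_left, real_inner_smul_left, real_inner_self_eq_norm_sq]

/-- Derivative of `t ↦ 2 ⟪m₀ + t • b, b⟫`: the constant `2 ‖b‖²`. [folklore] -/
theorem hasDerivAt_two_inner_line (m₀ b : V) (t : ℝ) :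
    HasDerivAt (fun s : ℝ => 2 * ⟪m₀ + s • b, b⟫) (2 * ‖b‖ ^ 2) t := by
  have h : HasDerivAt (fun s : ℝ => 2 * (⟪m₀, b⟫ + s * ‖b‖ ^ 2)) (2 * ‖b‖ ^ 2) t := by
    simpa using (((hasDerivAt_id t).mul_const (‖b‖ ^ 2)).const_add ⟪m₀, b⟫).const_mul 2
  have heq : (fun s : ℝ => 2 * ⟪m₀ + s • b, b⟫) = fun s : ℝ => 2 * (⟪m₀, b⟫ + s * ‖b‖ ^ 2) := by
    funext s
    rw [inner_line]
  rw [heq]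
  exact h

/-- An affine real function and its derivative. [folklore] -/
theorem hasDerivAt_affine (p v t : ℝ) : HasDerivAt (fun s : ℝ => p + s * v) v t := by
  simpa using ((hasDerivAt_id t).mul_const v).const_add p

/-! ### The equation-of-state part and the typed chamber -/

/-- **Convexity of the equation-of-state part.** If on `(0, η₀)` the function `F` has two
derivatives `F′, F″` with `2ηF′(η) + η²F″(η) ≥ -1/2`, then for `σ > 0` and `0 ≤ μ` with
`4μη₀ ≤ σ³` the function `ρ ↦ ρ log ρ + ρ F(ρσ³) - κρ - μρ²` is convex on `(0, η₀/σ³)`: its second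
derivative is `(1 + 2ηF′ + η²F″)/ρ - 2μ ≥ 1/(2ρ) - 2μ > 0`, `η = ρσ³`. [folklore] -/
theorem eosEntropy_convexOn {F F' F'' : ℝ → ℝ} {η₀ σ μ : ℝ} (κ : ℝ) (hσ : 0 < σ) (hη₀ : 0 < η₀)
    (hF : ∀ η ∈ Ioo 0 η₀, HasDerivAt F (F' η) η) (hF' : ∀ η ∈ Ioo 0 η₀, HasDerivAt F' (F'' η) η)
    (hbound : ∀ η ∈ Ioo 0 η₀, -(1 / 2) ≤ 2 * η * F' η + η ^ 2 * F'' η) (hμ0 : 0 ≤ μ)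
    (hμ : μ * (4 * η₀) ≤ σ ^ 3) :
    ConvexOn ℝ (Ioo 0 (η₀ / σ ^ 3))
      (fun ρ => ρ * Real.log ρ + ρ * F (ρ * σ ^ 3) - κ * ρ - μ * ρ ^ 2) := by
  have hσ3 : 0 < σ ^ 3 := by positivity
  -- points of the interval and their reduced densities
  have hη : ∀ ρ ∈ Ioo 0 (η₀ / σ ^ 3), ρ * σ ^ 3 ∈ Ioo 0 η₀ := by
    intro ρ hρ
    exact ⟨mul_pos hρ.1 hσ3, (lt_div_iff₀ hσ3).mp hρ.2⟩
  -- first derivative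
  have hd1 : ∀ ρ ∈ Ioo 0 (η₀ / σ ^ 3),
      HasDerivAt (fun ρ => ρ * Real.log ρ + ρ * F (ρ * σ ^ 3) - κ * ρ - μ * ρ ^ 2)
        (Real.log ρ + 1 + F (ρ * σ ^ 3) + ρ * σ ^ 3 * F' (ρ * σ ^ 3) - κ - 2 * μ * ρ) ρ := by
    intro ρ hρ
    have hρ0 : ρ ≠ 0 := hρ.1.ne'
    have hA := Real.hasDerivAt_mul_log hρ0
    have hcomp : HasDerivAt (fun x => F (x * σ ^ 3)) (F' (ρ * σ ^ 3) * σ ^ 3) ρ := by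
      have h1 : HasDerivAt (fun x : ℝ => x * σ ^ 3) (σ ^ 3) ρ := by
        simpa using (hasDerivAt_id ρ).mul_const (σ ^ 3)
      exact (hF _ (hη ρ hρ)).comp ρ h1
    have hB := (hasDerivAt_id ρ).mul hcomp
    have hC := (hasDerivAt_id ρ).const_mul κ
    have hD := ((hasDerivAt_id ρ).pow 2).const_mul μ
    refine (((hA.add hB).sub hC).sub hD).congr_deriv ?_
    simp only [id, Nat.cast_ofNat, Nat.add_one_sub_one, pow_one, one_mul, mul_one]
    ring
  -- second derivative
  have hd2 : ∀ ρ ∈ Ioo 0 (η₀ / σ ^ 3),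
      HasDerivAt (fun ρ => Real.log ρ + 1 + F (ρ * σ ^ 3) + ρ * σ ^ 3 * F' (ρ * σ ^ 3) - κ
          - 2 * μ * ρ)
        (1 / ρ + 2 * σ ^ 3 * F' (ρ * σ ^ 3) + ρ * σ ^ 6 * F'' (ρ * σ ^ 3) - 2 * μ) ρ := by
    intro ρ hρ
    have hρ0 : ρ ≠ 0 := hρ.1.ne'
    have hA := (Real.hasDerivAt_log hρ0).add_const 1
    have hcomp : HasDerivAt (fun x => F (x * σ ^ 3)) (F' (ρ * σ ^ 3) * σ ^ 3) ρ := by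
      have h1 : HasDerivAt (fun x : ℝ => x * σ ^ 3) (σ ^ 3) ρ := by
        simpa using (hasDerivAt_id ρ).mul_const (σ ^ 3)
      exact (hF _ (hη ρ hρ)).comp ρ h1
    have hcomp' : HasDerivAt (fun x => F' (x * σ ^ 3)) (F'' (ρ * σ ^ 3) * σ ^ 3) ρ := by
      have h1 : HasDerivAt (fun x : ℝ => x * σ ^ 3) (σ ^ 3) ρ := by
        simpa using (hasDerivAt_id ρ).mul_const (σ ^ 3)
      exact (hF' _ (hη ρ hρ)).comp ρ h1
    have hB := ((hasDerivAt_id ρ).mul_const (σ ^ 3)).mul hcomp'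
    have hC := (hasDerivAt_id ρ).const_mul (2 * μ)
    refine ((((hA.add hcomp).add hB).sub_const κ).sub hC).congr_deriv ?_
    simp only [id, one_mul, mul_one]
    ring
  -- nonnegativity of the second derivative
  have hnonneg : ∀ ρ ∈ Ioo 0 (η₀ / σ ^ 3),
      0 ≤ 1 / ρ + 2 * σ ^ 3 * F' (ρ * σ ^ 3) + ρ * σ ^ 6 * F'' (ρ * σ ^ 3) - 2 * μ := by
    intro ρ hρ
    have hρ0 : 0 < ρ := hρ.1
    have hb := hbound _ (hη ρ hρ)
    have hμρ : 2 * μ * ρ ≤ 1 / 2 := by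
      have h1 : μ * ρ ≤ μ * (η₀ / σ ^ 3) := mul_le_mul_of_nonneg_left hρ.2.le hμ0
      have h2 : μ * (η₀ / σ ^ 3) = μ * (4 * η₀) / (4 * σ ^ 3) := by
        field_simp
      have h3 : μ * (4 * η₀) / (4 * σ ^ 3) ≤ σ ^ 3 / (4 * σ ^ 3) :=
        div_le_div_of_nonneg_right hμ (by positivity)
      have h4 : σ ^ 3 / (4 * σ ^ 3) = 1 / 4 := by
        field_simp
      linarith only [h1, h2, h3, h4]
    have key : 0 ≤ ρ * (1 / ρ + 2 * σ ^ 3 * F' (ρ * σ ^ 3) + ρ * σ ^ 6 * F'' (ρ * σ ^ 3)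
        - 2 * μ) := by
      have : ρ * (1 / ρ + 2 * σ ^ 3 * F' (ρ * σ ^ 3) + ρ * σ ^ 6 * F'' (ρ * σ ^ 3) - 2 * μ)
          = 1 + (2 * (ρ * σ ^ 3) * F' (ρ * σ ^ 3) + (ρ * σ ^ 3) ^ 2 * F'' (ρ * σ ^ 3))
            - 2 * μ * ρ := by
        field_simp
        ring
      rw [this]
      linarith only [hb, hμρ]
    exact (mul_nonneg_iff_of_pos_left hρ0).mp key
  refine convexOn_of_hasDerivWithinAt2_nonneg (convex_Ioo 0 (η₀ / σ ^ 3))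
    (f' := fun ρ => Real.log ρ + 1 + F (ρ * σ ^ 3) + ρ * σ ^ 3 * F' (ρ * σ ^ 3) - κ - 2 * μ * ρ)
    (f'' := fun ρ => 1 / ρ + 2 * σ ^ 3 * F' (ρ * σ ^ 3) + ρ * σ ^ 6 * F'' (ρ * σ ^ 3) - 2 * μ)
    (fun ρ hρ => (hd1 ρ hρ).continuousAt.continuousWithinAt) ?_ ?_ ?_
  · rw [interior_Ioo]
    exact fun ρ hρ => (hd1 ρ hρ).hasDerivWithinAt
  · rw [interior_Ioo]
    exact fun ρ hρ => (hd2 ρ hρ).hasDerivWithinAt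
  · rw [interior_Ioo]
    exact hnonneg

/-- **Convexity of the typed chamber** `{c₁/2 < ρ, ρσ³ < η₀, ‖m‖² < 2ρE, E < E₁}` (`0 < c₁`): the
kinetic chamber cut by the half-space `ρσ³ < η₀`. [folklore] -/
theorem convex_typedChamber {V : Type*} [NormedAddCommGroup V] [InnerProductSpace ℝ V]
    (c₁ E₁ σ η₀ : ℝ) (hc₁ : 0 < c₁) :
    Convex ℝ {U : ℝ × V × ℝ | c₁ / 2 < U.1 ∧ U.1 * σ ^ 3 < η₀ ∧
      ‖U.2.1‖ ^ 2 < 2 * U.1 * U.2.2 ∧ U.2.2 < E₁} := by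
  have h1 := convex_kineticChamber (V := V) (c₁ / 2) E₁ (by positivity)
  have h2 : Convex ℝ {U : ℝ × V × ℝ | U.1 * σ ^ 3 < η₀} := by
    have := convex_halfSpace_lt (𝕜 := ℝ) (E := ℝ × V × ℝ) (β := ℝ)
      (f := fun U => U.1 * σ ^ 3) ⟨fun x y => by simp [add_mul], fun c x => by simp [mul_assoc]⟩
      η₀
    exact this
  have heq : {U : ℝ × V × ℝ | c₁ / 2 < U.1 ∧ U.1 * σ ^ 3 < η₀ ∧
      ‖U.2.1‖ ^ 2 < 2 * U.1 * U.2.2 ∧ U.2.2 < E₁}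
      = {U : ℝ × V × ℝ | c₁ / 2 < U.1 ∧ ‖U.2.1‖ ^ 2 < 2 * U.1 * U.2.2 ∧ U.2.2 < E₁}
        ∩ {U : ℝ × V × ℝ | U.1 * σ ^ 3 < η₀} := by
    ext U
    simp only [mem_setOf_eq, mem_inter_iff]
    tauto
  rw [heq]
  exact h1.inter h2

end Summit.AtomisticToContinuum.HydrodynamicLimit.Theorems
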